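import Literature.AlgebraicGeometry.Resolution.CentreBlowupAdaptedOrder
import Literature.AlgebraicGeometry.Resolution.PointBlowupKangaroo
import Mathlib.Algebra.MvPolynomial.PDeriv
import HarnessLib

/-!
# [Cossart–Piltant 2019, Example 3.2]: an infinite quadratic sequence along which the support of the
# arc is never a permissible centre

[CP19, Example 3.2 (p. 45)]: "Take `S = k[u₁,u₂,u₃,u₄]_{(u₁,u₂,u₃,u₄)}` with `k` a field of characteristic
`p > 0`. We let: `h = Z^p + u₂^p u₄u₃^p + u₃u₁^p ∈ S[Z]`. Then `(u₁,u₂,u₃,u₄)` are adapted to `(S,h,E)`,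
`E := div(u₁u₂)` … `Sing_p 𝒳 := {y ∈ 𝒳 : m(y) = p} = V(Z,u₁,u₂) ∪ V(Z,u₁,u₃)`, `ω(x) = p`.
Let `ϑ(t) := Σ_{i≥1} λᵢtⁱ ∈ k[[t]]` be a power series which is transcendental over `k(t)`. We define a
nonconstant well-parametrized `k`-linear formal arc on `(𝒳,x)` by:
`φ(Z) = φ(u₁) = φ(u₃) = 0`, `φ(u₂) = u₂`, `φ(u₄) = ϑ(t)^p`.
Let `u_j^{(0)} := u_j`, `1 ≤ j ≤ 4`. For `r ≥ 1`, well adapted coordinates at `x_r` are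
`u_j^{(r)} := u_j^{(r-1)}/u₂`, `j = 1,3`, `u₂^{(r)} := u₂` and
`v₄^{(r)} := u₂^{-r}(u₄ − Σ_{ip ≤ r} λᵢ^p u₂^{ip})`, `T_r := u₂^{-r}(Z + (u₃^{(r)})^p Σ_{ip ≤ r} λᵢ^p u₂^{ip})`.
Then `φ` lifts through `(𝒳_r,x_r)` … and the strict transform `h_r` of `h` is given by
`h_r := T_r^p + (u₂^{(r)})^r ((u₂^{(r)})^p v₄^{(r)} (u₃^{(r)})^p + u₃^{(r)} (u₁^{(r)})^p)`.
We have `Z_r := V(T_r, u₁^{(r)}, u₃^{(r)})` for every `r ≥ 1`. Note that `Z_r` is not permissible at `x_r`.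
Therefore `φ` fulfills alternative (2) of proposition 3.8."

This file replays the example in the coordinate-centre model (`PointBlowupShadeCentres`,
`CentreBlowupAdaptedOrder`; variables `0,1,2,3` for `u₁^{(r)}, u₂, u₃^{(r)}, u₄ / v₄^{(r)}`), for EVERY
`r` (written `n` below) at once:

1. the states `cp19Example32 p n`: `F_n = v₄·u₂^{n+p}u₃^p + u₃·u₂^n u₁^p`, boundary `exc = {u₁,u₂}`
   (`E = div(u₁u₂)`; `u₂ = 0` is the exceptional divisor of every point blow-up of the sequence and the
   strict transform of `u₁ = 0` keeps passing through `x_r`), multiplicity record `r = n·[u₂]`;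
2. `ε(x_n) = p + 1`, `ω(x_n) = p` for every `n` (`H_{u₁} = 0`, `H_{u₂} = n`, `F_{p,Z} = u₃u₂^n u₁^p`,
   `∂F_{p,Z}/∂u₃ ≠ 0` with `u₃ ∉ E`), in particular "`ω(x) = p`";
3. the QUADRATIC SEQUENCE ALONG `φ`: the point blow-up at `x_n` (the centre `C_univ`, of the first kind),
   read in the `u₂`-chart at the point `b = (0,0,0,b₄)` — `b₄ = λᵢ^p` at the steps `n + 1 = ip` and `b₄ = 0`
   otherwise — is again `p`-fold, and its cleaned state IS `cp19Example32 p (n+1)`: the chart law gives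
   `h_{n+1}` on the nose, the translation adds `b₄ (u₂)^{n+1+p}(u₃^{(n+1)})^p`, which is a `p`-th power
   exactly when `p ∣ n + 1` and is then deleted — this deletion is the printed change of variable
   `Z ↦ T_{n+1}`; so `ι` stalls forever along `φ` (`ω(x_{n+1}) = ω(x_n) = p`, `ε` constant);
4. "`Z_r` is not permissible at `x_r`": the surface `C_{{u₁,u₃}}` (`S = {0,2}`) is Hironaka-permissible
   (`ord_{C_S} F_n = p`), satisfies (ii) of Def. 3.2 (`ε(z_n) = p = ε(x_n) − 1`, so it is not of the first
   kind), and FAILS (iii): the only monomial of least `S`-degree, `v₄ u₂^{n+p} u₃^p`, carries the boundary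
   variable `u₂ ∉ S` with exponent `n + p`, which is neither `0` (undivided reading `HasTransverseLinear`)
   nor `H_{u₂} = n` (reading with `H_W` divided out, (3.1) p. 31) — for every `n` and every `p > 0`;
5. "`Sing_p 𝒳 ⊇ V(Z,u₁,u₂) ∪ V(Z,u₁,u₃)`": both coordinate surfaces are `p`-fold (`ord = n + p`, resp. `p`).

Scope: the case `G = 0`, constant coefficients, the walk's own coordinates (which are the printed well
adapted ones here); the transcendence of `ϑ` (which makes `Z_r` the whole surface `V(T_r,u₁^{(r)},u₃^{(r)})`)
is not modelled — the model statement is about the coordinate surface `S = {0,2}` at each `x_n`.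
Computations on a published example; nothing about resolution in general is asserted.
AI-assisted formalisation (observatory `pub-rosobs`, unit `pub-rosobs-carver-g25`); quotations from
arXiv:1412.0868 (PDF page 45).
-/

noncomputable section

open MvPolynomial Finset

open scoped BigOperators

namespace Literature.AlgebraicGeometry.Resolution

open Literature.AlgebraicGeometry.Resolution.Hauser2010
open Literature.AlgebraicGeometry.Resolution.HauserPerlega2019 (initialForm)

namespace CentreBlowup

/-! ### 0. Private helpers -/

section Helpers

variable {σ : Type*} {K : Type*}

/-- The `C_S`-chart transform of `y^{d₁} + y^{d₂}` (`d₁ ≠ d₂`). [folklore] -/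
private theorem chartTransform_binomial' [DecidableEq σ] [Field K] (q : ℕ) (S : Finset σ) (j : σ)
    {d₁ d₂ : σ →₀ ℕ} (h : d₁ ≠ d₂) :
    chartTransform q S j (monomial d₁ (1 : K) + monomial d₂ 1) =
      monomial (chartExponent q S j d₁) 1 + monomial (chartExponent q S j d₂) 1 := by
  unfold chartTransform
  rw [PointBlowup.support_binomial h, Finset.sum_pair h, coeff_add, coeff_add, coeff_monomial,
    coeff_monomial, coeff_monomial, coeff_monomial, if_pos rfl, if_pos rfl, if_neg h,
    if_neg (Ne.symm h), add_zero, zero_add]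

/-- `H_j ≤ d_j` for every monomial `y^d` of `F`. [folklore] -/
private theorem bigH_le_apply' [CommRing K] {F : MvPolynomial σ K} {d : σ →₀ ℕ} (hd : d ∈ F.support)
    (j : σ) : PointBlowup.bigH F j ≤ d j :=
  Finset.inf_le (f := fun d : σ →₀ ℕ => ((d j : ℕ) : ℕ∞)) hd

/-- Two centre-walk states with the same fields are equal. [folklore] -/
private theorem CState.eq_of_fields' [CommRing K] {s t : CState σ K} (hF : s.F = t.F) (hr : s.r = t.r)
    (he : s.exc = t.exc) : s = t := by
  obtain ⟨F, r, e⟩ := s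
  obtain ⟨F', r', e'⟩ := t
  simp only at hF hr he
  subst hF
  subst hr
  subst he
  rfl

/-- `Σ_{i ∈ {a, b}} dᵢ = d_a + d_b`. [folklore] -/
private theorem degIn_pair' {a b : σ} [DecidableEq σ] (h : a ≠ b) (d : σ →₀ ℕ) :
    degIn {a, b} d = d a + d b :=
  Finset.sum_pair h

end Helpers

variable {K : Type*} [Field K]

section Example

/-! ### 1. The states `x_n` of the quadratic sequence and their numbers -/

/-- Exponent of `v₄^{(n)} (u₂)^{n+p} (u₃^{(n)})^p` (variables `0,1,2,3` = `u₁^{(n)},u₂,u₃^{(n)},v₄^{(n)}`).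
[cite: CossartPiltant2019, Example 3.2 (p. 45)] -/
def cp19Example32ExpA (p n : ℕ) : Fin 4 →₀ ℕ :=
  Finsupp.single 3 1 + (Finsupp.single 1 (n + p) + Finsupp.single 2 p)

/-- Exponent of `u₃^{(n)} (u₂)^n (u₁^{(n)})^p`. [cite: CossartPiltant2019, Example 3.2 (p. 45)] -/
def cp19Example32ExpB (p n : ℕ) : Fin 4 →₀ ℕ :=
  Finsupp.single 2 1 + (Finsupp.single 1 n + Finsupp.single 0 p)

/-- The state at `x_n`: "`h_r := T_r^p + (u₂^{(r)})^r((u₂^{(r)})^p v₄^{(r)} (u₃^{(r)})^p + u₃^{(r)}(u₁^{(r)})^p)`"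
with `r = n`, i.e. `F_n = v₄·u₂^{n+p}u₃^p + u₃·u₂^n u₁^p`; boundary `{u₁, u₂}` ("`E := div(u₁u₂)`" at `n = 0`,
then the exceptional `u₂ = 0` and the strict transform of `u₁ = 0`); multiplicity record `n·[u₂]`.
[cite: CossartPiltant2019, Example 3.2 (p. 45)] -/
def cp19Example32 (p n : ℕ) : CState (Fin 4) K where
  F := X 3 * (X 1 ^ (n + p) * X 2 ^ p) + X 2 * (X 1 ^ n * X 0 ^ p)
  r := Finsupp.single 1 n
  exc := {0, 1}

/-- "`Z_r := V(T_r, u₁^{(r)}, u₃^{(r)})`": the coordinate surface `S = {0, 2}`.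
[cite: CossartPiltant2019, Example 3.2 (p. 45)] -/
def cp19Example32Centre : Finset (Fin 4) := {0, 2}

/-- At `n = 0` the state is the printed `h = Z^p + u₂^p u₄u₃^p + u₃u₁^p`.
[cite: CossartPiltant2019, Example 3.2 (p. 45)] -/
theorem cp19Example32_F_zero (p : ℕ) :
    (cp19Example32 p 0 : CState (Fin 4) K).F = X 1 ^ p * X 3 * X 2 ^ p + X 2 * X 0 ^ p := by
  show (X 3 * (X 1 ^ (0 + p) * X 2 ^ p) + X 2 * (X 1 ^ 0 * X 0 ^ p) : MvPolynomial (Fin 4) K) = _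
  rw [zero_add, pow_zero, one_mul]
  ring

/-- `(d_A)_{u₁} = 0`. [cite: CossartPiltant2019, Example 3.2 (p. 45)] -/
theorem cp19Example32ExpA_zero (p n : ℕ) : cp19Example32ExpA p n 0 = 0 := by simp [cp19Example32ExpA]

/-- `(d_A)_{u₂} = n + p`. [cite: CossartPiltant2019, Example 3.2 (p. 45)] -/
theorem cp19Example32ExpA_one (p n : ℕ) : cp19Example32ExpA p n 1 = n + p := by simp [cp19Example32ExpA]

/-- `(d_A)_{u₃} = p`. [cite: CossartPiltant2019, Example 3.2 (p. 45)] -/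
theorem cp19Example32ExpA_two (p n : ℕ) : cp19Example32ExpA p n 2 = p := by simp [cp19Example32ExpA]

/-- `(d_A)_{v₄} = 1`. [cite: CossartPiltant2019, Example 3.2 (p. 45)] -/
theorem cp19Example32ExpA_three (p n : ℕ) : cp19Example32ExpA p n 3 = 1 := by simp [cp19Example32ExpA]

/-- `(d_B)_{u₁} = p`. [cite: CossartPiltant2019, Example 3.2 (p. 45)] -/
theorem cp19Example32ExpB_zero (p n : ℕ) : cp19Example32ExpB p n 0 = p := by simp [cp19Example32ExpB]

/-- `(d_B)_{u₂} = n`. [cite: CossartPiltant2019, Example 3.2 (p. 45)] -/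
theorem cp19Example32ExpB_one (p n : ℕ) : cp19Example32ExpB p n 1 = n := by simp [cp19Example32ExpB]

/-- `(d_B)_{u₃} = 1`. [cite: CossartPiltant2019, Example 3.2 (p. 45)] -/
theorem cp19Example32ExpB_two (p n : ℕ) : cp19Example32ExpB p n 2 = 1 := by simp [cp19Example32ExpB]

/-- `(d_B)_{v₄} = 0`. [cite: CossartPiltant2019, Example 3.2 (p. 45)] -/
theorem cp19Example32ExpB_three (p n : ℕ) : cp19Example32ExpB p n 3 = 0 := by simp [cp19Example32ExpB]

/-- `d_A ≠ d_B`. [cite: CossartPiltant2019, Example 3.2 (p. 45)] -/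
theorem cp19Example32ExpA_ne_ExpB (p n : ℕ) : cp19Example32ExpA p n ≠ cp19Example32ExpB p n := by
  intro h
  have h3 := DFunLike.congr_fun h 3
  rw [cp19Example32ExpA_three, cp19Example32ExpB_three] at h3
  exact one_ne_zero h3

/-- `|d_A| = n + 2p + 1`. [cite: CossartPiltant2019, Example 3.2 (p. 45)] -/
theorem degree_cp19Example32ExpA (p n : ℕ) : (cp19Example32ExpA p n).degree = n + p + 1 + p := by
  simp only [cp19Example32ExpA, map_add, Finsupp.degree_single]; omega

/-- `|d_B| = n + p + 1`. [cite: CossartPiltant2019, Example 3.2 (p. 45)] -/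
theorem degree_cp19Example32ExpB (p n : ℕ) : (cp19Example32ExpB p n).degree = n + p + 1 := by
  simp only [cp19Example32ExpB, map_add, Finsupp.degree_single]; omega

/-- `F_n = y^{d_A} + y^{d_B}`. [cite: CossartPiltant2019, Example 3.2 (p. 45)] -/
theorem cp19Example32_F (p n : ℕ) :
    (cp19Example32 p n : CState (Fin 4) K).F =
      monomial (cp19Example32ExpA p n) 1 + monomial (cp19Example32ExpB p n) 1 := by
  show (X 3 * (X 1 ^ (n + p) * X 2 ^ p) + X 2 * (X 1 ^ n * X 0 ^ p) : MvPolynomial (Fin 4) K) = _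
  have h2 : (X 2 : MvPolynomial (Fin 4) K) = monomial (Finsupp.single 2 1) 1 := rfl
  have h3 : (X 3 : MvPolynomial (Fin 4) K) = monomial (Finsupp.single 3 1) 1 := rfl
  rw [X_pow_eq_monomial, X_pow_eq_monomial, X_pow_eq_monomial, X_pow_eq_monomial, h3, h2]
  simp only [monomial_mul, mul_one]
  rfl

/-- `supp F_n = {d_A, d_B}`. [cite: CossartPiltant2019, Example 3.2 (p. 45)] -/
theorem cp19Example32_support (p n : ℕ) :
    (cp19Example32 p n : CState (Fin 4) K).F.support = {cp19Example32ExpA p n, cp19Example32ExpB p n} := by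
  rw [cp19Example32_F, PointBlowup.support_binomial (cp19Example32ExpA_ne_ExpB p n)]

/-- `ord₀ F_n = n + p + 1` (`p δ(x_n)`). [cite: CossartPiltant2019, Example 3.2 (p. 45)] -/
theorem cp19Example32_ordZero (p n : ℕ) :
    ordZero (cp19Example32 p n : CState (Fin 4) K).F = (n + p + 1 : ℕ) := by
  rw [cp19Example32_F, PointBlowup.ordZero_binomial (cp19Example32ExpA_ne_ExpB p n)
    (by rw [degree_cp19Example32ExpA, degree_cp19Example32ExpB]; omega), degree_cp19Example32ExpB]

/-- `H_{u₁} = 0` (`u₁ ∤ v₄u₂^{n+p}u₃^p`). [cite: CossartPiltant2019, Example 3.2 (p. 45) with Def. 2.10 (p. 16)] -/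
theorem cp19Example32_bigH_zero (p n : ℕ) :
    PointBlowup.bigH (cp19Example32 p n : CState (Fin 4) K).F 0 = 0 := by
  have hA : cp19Example32ExpA p n ∈ (cp19Example32 p n : CState (Fin 4) K).F.support := by
    rw [cp19Example32_support]; exact Finset.mem_insert_self _ _
  have h := bigH_le_apply' hA 0
  rw [cp19Example32ExpA_zero, Nat.cast_zero] at h
  exact nonpos_iff_eq_zero.mp h

/-- `H_{u₂} = n` (the factor `(u₂^{(r)})^r` of `h_r − T_r^p`). [cite: CossartPiltant2019, Example 3.2 (p. 45) with Def. 2.10 (p. 16)] -/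
theorem cp19Example32_bigH_one (p n : ℕ) :
    PointBlowup.bigH (cp19Example32 p n : CState (Fin 4) K).F 1 = n := by
  apply le_antisymm
  · have hB : cp19Example32ExpB p n ∈ (cp19Example32 p n : CState (Fin 4) K).F.support := by
      rw [cp19Example32_support]; exact Finset.mem_insert_of_mem (Finset.mem_singleton_self _)
    have h := bigH_le_apply' hB 1
    rwa [cp19Example32ExpB_one] at h
  · unfold PointBlowup.bigH
    rw [cp19Example32_support, Finset.inf_insert, Finset.inf_singleton, cp19Example32ExpA_one,
      cp19Example32ExpB_one]
    exact le_inf (by exact_mod_cast Nat.le_add_right n p) le_rfl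

/-- `ε(x_n) = ord₀ F_n − (H_{u₁} + H_{u₂}) = p + 1` for every `n`.
[cite: CossartPiltant2019, Example 3.2 (p. 45) with Def. 2.9 (p. 15)] -/
theorem cp19Example32_epsilon (p n : ℕ) :
    (cp19Example32 p n : CState (Fin 4) K).epsilon = (p + 1 : ℕ) := by
  rw [CState.epsilon_eq, cp19Example32_ordZero]
  show ((n + p + 1 : ℕ) : ℕ∞) -
      ∑ j ∈ ({0, 1} : Finset (Fin 4)), PointBlowup.bigH (cp19Example32 p n : CState (Fin 4) K).F j = _
  rw [Finset.sum_pair (show (0 : Fin 4) ≠ 1 by decide), cp19Example32_bigH_zero, cp19Example32_bigH_one,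
    zero_add, ← ENat.coe_sub, show n + p + 1 - n = p + 1 by omega]

/-- `F_{p,Z} = u₃ u₂^n u₁^p` (the monomial of least degree; `p > 0`).
[cite: CossartPiltant2019, Example 3.2 (p. 45) with Def. 2.16 (p. 24)] -/
theorem cp19Example32_initialForm {p : ℕ} (hp : 0 < p) (n : ℕ) :
    initialForm (cp19Example32 p n : CState (Fin 4) K).F = monomial (cp19Example32ExpB p n) 1 := by
  unfold HauserPerlega2019.initialForm
  rw [cp19Example32_ordZero, ENat.toNat_coe, cp19Example32_F, map_add,
    homogeneousComponent_of_mem ((mem_homogeneousSubmodule _ _).mpr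
      (isHomogeneous_monomial _ (degree_cp19Example32ExpA p n))),
    homogeneousComponent_of_mem ((mem_homogeneousSubmodule _ _).mpr
      (isHomogeneous_monomial _ (degree_cp19Example32ExpB p n))),
    if_neg (by omega), if_pos rfl, zero_add]

/-- `∂F_{p,Z}/∂u₃ = u₂^n u₁^p`. [cite: CossartPiltant2019, Example 3.2 (p. 45) with Def. 2.16 (p. 24)] -/
theorem cp19Example32_pderiv {p : ℕ} (hp : 0 < p) (n : ℕ) :
    pderiv 2 (initialForm (cp19Example32 p n : CState (Fin 4) K).F) =
      monomial (Finsupp.single 1 n + Finsupp.single 0 p) 1 := by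
  have hB : cp19Example32ExpB p n - Finsupp.single 2 1 = Finsupp.single 1 n + Finsupp.single 0 p :=
    add_tsub_cancel_left _ _
  rw [cp19Example32_initialForm hp, pderiv_monomial, cp19Example32ExpB_two, Nat.cast_one, mul_one, hB]

/-- `V(F_{p,Z},E,m_S) ≠ 0`: `u₃ ∉ E` and `∂F_{p,Z}/∂u₃ ≠ 0`.
[cite: CossartPiltant2019, Example 3.2 (p. 45) with Def. 2.16 (p. 24)] -/
theorem cp19Example32_vNonzero {p : ℕ} (hp : 0 < p) (n : ℕ) :
    PointBlowup.VNonzero (cp19Example32 p n : CState (Fin 4) K).exc (cp19Example32 p n : CState (Fin 4) K).F :=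
  ⟨2, (show (2 : Fin 4) ∉ ({0, 1} : Finset (Fin 4)) by decide), by
    rw [cp19Example32_pderiv hp, Ne, monomial_eq_zero]; exact one_ne_zero⟩

/-- "`ω(x) = p`" — and `ω(x_n) = ε(x_n) − 1 = p` for every `n`.
[cite: CossartPiltant2019, Example 3.2 (p. 45) with Def. 2.16 (p. 24)] -/
theorem cp19Example32_omega {p : ℕ} (hp : 0 < p) (n : ℕ) :
    (cp19Example32 p n : CState (Fin 4) K).omega = p := by
  rw [CState.omega_eq_of_vNonzero _ (cp19Example32_vNonzero hp n), cp19Example32_epsilon, ← ENat.coe_one,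
    ← ENat.coe_sub, Nat.add_sub_cancel]

/-! ### 2. "`Z_r` is not permissible at `x_r`" -/

/-- `Σ_{i ∈ S} dᵢ = d₀ + d₂` for `S = {0, 2}`. [cite: CossartPiltant2019, Example 3.2 (p. 45)] -/
theorem degIn_cp19Example32Centre (d : Fin 4 →₀ ℕ) : degIn cp19Example32Centre d = d 0 + d 2 :=
  degIn_pair' (show (0 : Fin 4) ≠ 2 by decide) d

/-- `deg_S d_A = p`. [cite: CossartPiltant2019, Example 3.2 (p. 45)] -/
theorem degIn_centre_cp19Example32ExpA (p n : ℕ) : degIn cp19Example32Centre (cp19Example32ExpA p n) = p := by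
  rw [degIn_cp19Example32Centre, cp19Example32ExpA_zero, cp19Example32ExpA_two, zero_add]

/-- `deg_S d_B = p + 1`. [cite: CossartPiltant2019, Example 3.2 (p. 45)] -/
theorem degIn_centre_cp19Example32ExpB (p n : ℕ) :
    degIn cp19Example32Centre (cp19Example32ExpB p n) = p + 1 := by
  rw [degIn_cp19Example32Centre, cp19Example32ExpB_zero, cp19Example32ExpB_two]

/-- `ord_{Z_n} F_n = p` (`p δ(z_n)`). [cite: CossartPiltant2019, Example 3.2 (p. 45)] -/
theorem cp19Example32_ordAlong (p n : ℕ) :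
    ordAlong cp19Example32Centre (cp19Example32 p n : CState (Fin 4) K).F = p := by
  unfold ordAlong
  rw [cp19Example32_support, Finset.inf_insert, Finset.inf_singleton, degIn_centre_cp19Example32ExpA,
    degIn_centre_cp19Example32ExpB]
  exact inf_eq_left.mpr (by exact_mod_cast Nat.le_succ p)

/-- `ε(z_n) = ord_{Z_n} F_n − H_{u₁} = p` (`u₁` is the only boundary component containing `Z_n`).
[cite: CossartPiltant2019, Example 3.2 (p. 45) with Def. 2.9–2.10 (p. 15–16)] -/
theorem cp19Example32_epsilonAlong (p n : ℕ) :
    epsilonAlong cp19Example32Centre (cp19Example32 p n : CState (Fin 4) K) = p := by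
  unfold epsilonAlong
  show ordAlong cp19Example32Centre (cp19Example32 p n : CState (Fin 4) K).F -
      ∑ j ∈ (({0, 2} : Finset (Fin 4)) ∩ {0, 1}), PointBlowup.bigH (cp19Example32 p n : CState (Fin 4) K).F j = _
  rw [show (({0, 2} : Finset (Fin 4)) ∩ {0, 1}) = {0} by decide, Finset.sum_singleton,
    cp19Example32_bigH_zero, tsub_zero, cp19Example32_ordAlong]

/-- `Z_n` is Hironaka-permissible at `x_n` (`Z_n ⊆ Sing_p 𝒳_n`, normal crossings with `E_n`).
[cite: CossartPiltant2019, Example 3.2 (p. 45) with Def. 2.7 (p. 14)] -/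
theorem cp19Example32_isHironakaPermissible (p n : ℕ) :
    IsHironakaPermissible p cp19Example32Centre (cp19Example32 p n : CState (Fin 4) K) :=
  ⟨⟨0, by decide⟩, (cp19Example32_ordAlong p n).ge⟩

/-- (ii) of Def. 3.2 holds: `ε(z_n) + 1 = ε(x_n)`. [cite: CossartPiltant2019, Example 3.2 (p. 45) with Def. 3.2 (p. 32)] -/
theorem cp19Example32_epsilonAlong_add_one (p n : ℕ) :
    epsilonAlong cp19Example32Centre (cp19Example32 p n : CState (Fin 4) K) + 1 =
      (cp19Example32 p n : CState (Fin 4) K).epsilon := by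
  rw [cp19Example32_epsilonAlong, cp19Example32_epsilon, Nat.cast_add_one]

/-- `Z_n` is not permissible of the first kind (`ε(z_n) = p ≠ p + 1 = ε(x_n)`).
[cite: CossartPiltant2019, Example 3.2 (p. 45) with Def. 3.1 (p. 31)] -/
theorem cp19Example32_not_isFirstKind (p n : ℕ) :
    ¬ IsFirstKind p cp19Example32Centre (cp19Example32 p n : CState (Fin 4) K) := by
  rintro ⟨-, h⟩
  rw [cp19Example32_epsilonAlong, cp19Example32_epsilon] at h
  have := ENat.coe_inj.mp h
  omega

/-- (iii) of Def. 3.2 FAILS at `Z_n` (undivided reading): the only monomial of least `S`-degree,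
`v₄ u₂^{n+p} u₃^p`, carries the boundary variable `u₂ ∉ S` with exponent `n + p ≠ 0` (`p > 0`).
[cite: CossartPiltant2019, Example 3.2 (p. 45) with Def. 3.2 (iii) (p. 32)] -/
theorem cp19Example32_not_hasTransverseLinear {p : ℕ} (hp : 0 < p) (n : ℕ) :
    ¬ HasTransverseLinear cp19Example32Centre (cp19Example32 p n : CState (Fin 4) K) := by
  rintro ⟨d, hd, hdeg, t, -, htE, -, hrest⟩
  rw [cp19Example32_support, Finset.mem_insert, Finset.mem_singleton] at hd
  rcases hd with rfl | rfl
  · have hut : (1 : Fin 4) ≠ t := by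
      rintro rfl
      exact htE (show (1 : Fin 4) ∈ ({0, 1} : Finset (Fin 4)) by decide)
    have h1 := hrest 1 (by decide) hut
    rw [cp19Example32ExpA_one] at h1
    omega
  · rw [degIn_centre_cp19Example32ExpB, cp19Example32_ordAlong] at hdeg
    have := ENat.coe_inj.mp hdeg
    omega

/-- (iii) fails also with `H_W` divided out ((3.1), p. 31: `H_W ∋ ū₂^{H_{u₂}} = u₂^n`): on every monomial
of least `S`-degree the exponent of `u₂` is `n + p ≠ n = H_{u₂}` — after dividing by `u₂^n` a factor
`u₂^p` remains, so `cl₀(H_W⁻¹ ∂F_{p,Z,W}/∂v̄₄) = 0`.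
[cite: CossartPiltant2019, Example 3.2 (p. 45) with (3.1) (p. 31) and Prop. 3.3 (p. 32)] -/
theorem cp19Example32_boundaryExponent_ne_bigH {p : ℕ} (hp : 0 < p) (n : ℕ) :
    ∀ d ∈ (cp19Example32 p n : CState (Fin 4) K).F.support,
      (degIn cp19Example32Centre d : ℕ∞) = ordAlong cp19Example32Centre (cp19Example32 p n : CState (Fin 4) K).F →
        ((d 1 : ℕ) : ℕ∞) ≠ PointBlowup.bigH (cp19Example32 p n : CState (Fin 4) K).F 1 := by
  intro d hd hdeg
  rw [cp19Example32_bigH_one]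
  rw [cp19Example32_support, Finset.mem_insert, Finset.mem_singleton] at hd
  rcases hd with rfl | rfl
  · rw [cp19Example32ExpA_one]
    intro h
    have := ENat.coe_inj.mp h
    omega
  · rw [degIn_centre_cp19Example32ExpB, cp19Example32_ordAlong] at hdeg
    have := ENat.coe_inj.mp hdeg
    omega

/-- `Z_n` is not permissible of the second kind. [cite: CossartPiltant2019, Example 3.2 (p. 45) with Def. 3.2 (p. 32)] -/
theorem cp19Example32_not_isSecondKind {p : ℕ} (hp : 0 < p) (n : ℕ) :
    ¬ IsSecondKind p cp19Example32Centre (cp19Example32 p n : CState (Fin 4) K) :=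
  fun h => cp19Example32_not_hasTransverseLinear hp n h.2.2

/-- "Note that `Z_r` is not permissible at `x_r`" — for every `r`.
[cite: CossartPiltant2019, Example 3.2 (p. 45)] -/
theorem cp19Example32_not_isPermissibleCentre {p : ℕ} (hp : 0 < p) (n : ℕ) :
    ¬ IsPermissibleCentre p cp19Example32Centre (cp19Example32 p n : CState (Fin 4) K) := by
  rintro (h | h)
  exacts [cp19Example32_not_isFirstKind p n h, cp19Example32_not_isSecondKind hp n h]

/-! ### 3. "`Sing_p 𝒳 = V(Z,u₁,u₂) ∪ V(Z,u₁,u₃)`": both coordinate surfaces are `p`-fold -/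

/-- `ord_{V(u₁,u₂)} F_n = n + p` (`= p` at `n = 0`). [cite: CossartPiltant2019, Example 3.2 (p. 45)] -/
theorem cp19Example32_ordAlong_zero_one (p n : ℕ) :
    ordAlong ({0, 1} : Finset (Fin 4)) (cp19Example32 p n : CState (Fin 4) K).F = (n + p : ℕ) := by
  unfold ordAlong
  rw [cp19Example32_support, Finset.inf_insert, Finset.inf_singleton,
    degIn_pair' (show (0 : Fin 4) ≠ 1 by decide), degIn_pair' (show (0 : Fin 4) ≠ 1 by decide),
    cp19Example32ExpA_zero, cp19Example32ExpA_one, cp19Example32ExpB_zero, cp19Example32ExpB_one, zero_add,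
    Nat.add_comm p n, inf_idem]

/-- `V(Z,u₁,u₂) ⊆ Sing_p 𝒳_n`: Hironaka-permissible. [cite: CossartPiltant2019, Example 3.2 (p. 45)] -/
theorem cp19Example32_isHironakaPermissible_zero_one (p n : ℕ) :
    IsHironakaPermissible p ({0, 1} : Finset (Fin 4)) (cp19Example32 p n : CState (Fin 4) K) :=
  ⟨⟨0, by decide⟩, by rw [cp19Example32_ordAlong_zero_one]; exact_mod_cast Nat.le_add_left p n⟩

/-! ### 4. The quadratic sequence along `φ`: the point blow-up at `x_n` gives `x_{n+1}` -/

/-- The point `x_n` itself (`S = univ`) is a permissible centre of the first kind (`m(x_n) = p`).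
[cite: CossartPiltant2019, Example 3.2 (p. 45) with Def. 3.1 (p. 31)] -/
theorem cp19Example32_isFirstKind_point (p n : ℕ) :
    IsFirstKind p Finset.univ (cp19Example32 p n : CState (Fin 4) K) :=
  isFirstKind_univ p _ (by rw [cp19Example32_ordZero]; exact_mod_cast (by omega : p ≤ n + p + 1))

/-- `u₂`-chart law on `d_A`: `v₄ u₂^{n+p} u₃^p ↦ v₄ u₂^{n+1+p} u₃^p`. [cite: CossartPiltant2019, Example 3.2 (p. 45)] -/
theorem chartExponent_cp19Example32ExpA (p n : ℕ) :
    chartExponent p Finset.univ 1 (cp19Example32ExpA p n) = cp19Example32ExpA p (n + 1) := by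
  unfold chartExponent
  rw [degIn_univ, degree_cp19Example32ExpA, show n + p + 1 + p - p = n + 1 + p by omega]
  ext i
  rw [Finsupp.update_apply]
  split_ifs with h
  · rw [h, cp19Example32ExpA_one]
  · simp only [cp19Example32ExpA, Finsupp.add_apply, Finsupp.single_eq_of_ne h]

/-- `u₂`-chart law on `d_B`: `u₃ u₂^n u₁^p ↦ u₃ u₂^{n+1} u₁^p`. [cite: CossartPiltant2019, Example 3.2 (p. 45)] -/
theorem chartExponent_cp19Example32ExpB (p n : ℕ) :
    chartExponent p Finset.univ 1 (cp19Example32ExpB p n) = cp19Example32ExpB p (n + 1) := by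
  unfold chartExponent
  rw [degIn_univ, degree_cp19Example32ExpB, show n + p + 1 - p = n + 1 by omega]
  ext i
  rw [Finsupp.update_apply]
  split_ifs with h
  · rw [h, cp19Example32ExpB_one]
  · simp only [cp19Example32ExpB, Finsupp.add_apply, Finsupp.single_eq_of_ne h]

/-- The `u₂`-chart transform of `F_n` is `F_{n+1}` — "`u_j^{(r)} := u_j^{(r-1)}/u₂`, `j = 1,3`".
[cite: CossartPiltant2019, Example 3.2 (p. 45)] -/
theorem cp19Example32_chartTransform (p n : ℕ) :
    chartTransform p Finset.univ 1 (cp19Example32 p n : CState (Fin 4) K).F =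
      (cp19Example32 p (n + 1) : CState (Fin 4) K).F := by
  rw [cp19Example32_F, cp19Example32_F,
    chartTransform_binomial' p Finset.univ 1 (cp19Example32ExpA_ne_ExpB p n),
    chartExponent_cp19Example32ExpA, chartExponent_cp19Example32ExpB]

/-- At the point `b = (0,0,0,b₄)` of the `u₂`-chart (the lift of `φ`: `b₄ = λᵢ^p` if `n + 1 = ip`, else `0`)
the uncleaned transform is `F_{n+1} + b₄ · u₂^{n+1+p} u₃^p` ("`v₄^{(r)} := u₂^{-r}(u₄ − Σ_{ip≤r} λᵢ^p u₂^{ip})`").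
[cite: CossartPiltant2019, Example 3.2 (p. 45)] -/
theorem cp19Example32_pointTransform (p n : ℕ) (b : Fin 4 → K) (hb0 : b 0 = 0) (hb1 : b 1 = 0)
    (hb2 : b 2 = 0) :
    pointTransform p Finset.univ 1 b (cp19Example32 p n) =
      (cp19Example32 p (n + 1) : CState (Fin 4) K).F + C (b 3) * (X 1 ^ (n + 1 + p) * X 2 ^ p) := by
  unfold pointTransform PointBlowup.translate
  rw [cp19Example32_chartTransform]
  show aeval (fun i => (X i + C (b i) : MvPolynomial (Fin 4) K))
      (X 3 * (X 1 ^ (n + 1 + p) * X 2 ^ p) + X 2 * (X 1 ^ (n + 1) * X 0 ^ p)) =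
    X 3 * (X 1 ^ (n + 1 + p) * X 2 ^ p) + X 2 * (X 1 ^ (n + 1) * X 0 ^ p) +
      C (b 3) * (X 1 ^ (n + 1 + p) * X 2 ^ p)
  simp only [map_add, map_mul, map_pow, aeval_X, hb0, hb1, hb2, C_0, add_zero]
  rw [add_mul, add_right_comm]

/-- The same in monomial form. [cite: CossartPiltant2019, Example 3.2 (p. 45)] -/
theorem cp19Example32_pointTransform_eq (p n : ℕ) (b : Fin 4 → K) (hb0 : b 0 = 0) (hb1 : b 1 = 0)
    (hb2 : b 2 = 0) :
    pointTransform p Finset.univ 1 b (cp19Example32 p n) =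
      monomial (cp19Example32ExpA p (n + 1)) 1 + monomial (cp19Example32ExpB p (n + 1)) 1 +
        monomial (Finsupp.single 1 (n + 1 + p) + Finsupp.single 2 p) (b 3) := by
  rw [cp19Example32_pointTransform p n b hb0 hb1 hb2, cp19Example32_F, X_pow_eq_monomial, X_pow_eq_monomial,
    monomial_mul, C_mul_monomial]
  simp only [mul_one]

/-- `x_{n+1}` is again a point of multiplicity `p` (every monomial of the transform has degree `> p`).
[cite: CossartPiltant2019, Example 3.2 (p. 45)] -/
theorem cp19Example32_isEquimultiplePoint (p n : ℕ) (b : Fin 4 → K) (hb0 : b 0 = 0) (hb1 : b 1 = 0)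
    (hb2 : b 2 = 0) : IsEquimultiplePoint p Finset.univ 1 b (cp19Example32 p n) := by
  intro d _ hdeg
  have hA : cp19Example32ExpA p (n + 1) ≠ d := fun h => by
    have := congrArg Finsupp.degree h; rw [degree_cp19Example32ExpA] at this; omega
  have hB : cp19Example32ExpB p (n + 1) ≠ d := fun h => by
    have := congrArg Finsupp.degree h; rw [degree_cp19Example32ExpB] at this; omega
  have hD : (Finsupp.single 1 (n + 1 + p) + Finsupp.single 2 p : Fin 4 →₀ ℕ) ≠ d := fun h => by
    have := congrArg Finsupp.degree h
    rw [map_add, Finsupp.degree_single, Finsupp.degree_single] at this; omega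
  rw [cp19Example32_pointTransform_eq p n b hb0 hb1 hb2, coeff_add, coeff_add, coeff_monomial, coeff_monomial,
    coeff_monomial, if_neg hA, if_neg hB, if_neg hD, add_zero, add_zero]

/-- `d_A` is not a `p`-th power exponent (`v₄` to the first power; `p > 1`). [cite: CossartPiltant2019, Example 3.2 (p. 45)] -/
theorem not_isPthPowerExponent_cp19Example32ExpA {p : ℕ} (hp : 1 < p) (n : ℕ) :
    ¬ IsPthPowerExponent p (cp19Example32ExpA p n) := by
  rw [isPthPowerExponent_iff]
  intro h
  have h3 := h 3
  rw [cp19Example32ExpA_three] at h3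
  have := Nat.dvd_one.mp h3
  omega

/-- `d_B` is not a `p`-th power exponent (`u₃` to the first power; `p > 1`). [cite: CossartPiltant2019, Example 3.2 (p. 45)] -/
theorem not_isPthPowerExponent_cp19Example32ExpB {p : ℕ} (hp : 1 < p) (n : ℕ) :
    ¬ IsPthPowerExponent p (cp19Example32ExpB p n) := by
  rw [isPthPowerExponent_iff]
  intro h
  have h2 := h 2
  rw [cp19Example32ExpB_two] at h2
  have := Nat.dvd_one.mp h2
  omega

/-- The translation term `b₄ u₂^{n+1+p} u₃^p` is a `p`-th power monomial iff `p ∣ n + 1`.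
[cite: CossartPiltant2019, Example 3.2 (p. 45)] -/
theorem isPthPowerExponent_cp19Example32Shift (p n : ℕ) :
    IsPthPowerExponent p (Finsupp.single (1 : Fin 4) (n + 1 + p) + Finsupp.single 2 p) ↔ p ∣ n + 1 := by
  rw [isPthPowerExponent_iff]
  constructor
  · intro h
    have h1 := h 1
    rw [Finsupp.add_apply, Finsupp.single_eq_same,
      Finsupp.single_eq_of_ne (show (1 : Fin 4) ≠ 2 by decide), add_zero] at h1
    exact (Nat.dvd_add_left (dvd_refl p)).mp h1
  · intro hdvd i
    rw [Finsupp.add_apply]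
    by_cases h1 : i = 1
    · subst h1
      rw [Finsupp.single_eq_same, Finsupp.single_eq_of_ne (show (1 : Fin 4) ≠ 2 by decide), add_zero]
      exact dvd_add hdvd (dvd_refl p)
    · rw [Finsupp.single_eq_of_ne h1, zero_add]
      by_cases h2 : i = 2
      · subst h2; rw [Finsupp.single_eq_same]
      · rw [Finsupp.single_eq_of_ne h2]; exact dvd_zero p

section Step

variable [DecidableEq K]

/-- The cleaned state at `x_{n+1}` has residual polynomial `F_{n+1}` — "the strict transform `h_r` of `h`
is given by `h_r := T_r^p + (u₂^{(r)})^r(…)`": along `φ` either `b₄ = 0`, or `n + 1 = ip` and the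
translation term `λᵢ^p u₂^{n+1+p} u₃^p = (λᵢ u₂^{i+1} u₃^{(n+1)})^p` is a `p`-th power, deleted by the
cleaning (the printed change of variable `Z ↦ T_{n+1}`).  (`p > 1`.)
[cite: CossartPiltant2019, Example 3.2 (p. 45)] -/
theorem cp19Example32_step_F {p : ℕ} (hp : 1 < p) (n : ℕ) (b : Fin 4 → K) (hb0 : b 0 = 0)
    (hb1 : b 1 = 0) (hb2 : b 2 = 0) (h : b 3 = 0 ∨ p ∣ n + 1) :
    (step p Finset.univ 1 b (cp19Example32 p n)).F = (cp19Example32 p (n + 1) : CState (Fin 4) K).F := by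
  show deletePthPowers p (pointTransform p Finset.univ 1 b (cp19Example32 p n)) = _
  rw [cp19Example32_pointTransform_eq p n b hb0 hb1 hb2, deletePthPowers_add,
    PointBlowup.deletePthPowers_binomial p (not_isPthPowerExponent_cp19Example32ExpA hp (n + 1))
      (not_isPthPowerExponent_cp19Example32ExpB hp (n + 1)), deletePthPowers_monomial, cp19Example32_F]
  rcases h with hc | hdvd
  · rw [hc, monomial_zero, ite_self, add_zero]
  · rw [if_pos ((isPthPowerExponent_cp19Example32Shift p n).mpr hdvd), add_zero]

/-- The boundary at `x_{n+1}`: the exceptional divisor `u₂ = 0` and the strict transform of `u₁ = 0`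
(`b₁ = 0`), i.e. again `{u₁, u₂}`. [cite: CossartPiltant2019, Example 3.2 (p. 45)] -/
theorem cp19Example32_step_exc (p n : ℕ) (b : Fin 4 → K) (hb0 : b 0 = 0) (hb1 : b 1 = 0) :
    (step p Finset.univ 1 b (cp19Example32 p n)).exc = {0, 1} := by
  show insert (1 : Fin 4) ((({0, 1} : Finset (Fin 4))).filter fun i => b i = 0) = {0, 1}
  have hfilter : ((({0, 1} : Finset (Fin 4))).filter fun i => b i = 0) = {0, 1} :=
    Finset.filter_true_of_mem fun i hi => by
      rw [Finset.mem_insert, Finset.mem_singleton] at hi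
      rcases hi with rfl | rfl
      exacts [hb0, hb1]
  rw [hfilter]
  decide

/-- The multiplicity record at `x_{n+1}`: `(n + 1)·[u₂]` (`ord₀ F_n − p = n + 1`).
[cite: CossartPiltant2019, Example 3.2 (p. 45)] -/
theorem cp19Example32_step_r (p n : ℕ) (b : Fin 4 → K) :
    (step p Finset.univ 1 b (cp19Example32 p n)).r = Finsupp.single 1 (n + 1) := by
  show ((Finsupp.single (1 : Fin 4) n).filter fun i => b i = 0).update 1
      ((ordAlong Finset.univ (cp19Example32 p n : CState (Fin 4) K).F).toNat - p) = Finsupp.single 1 (n + 1)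
  rw [ordAlong_univ, cp19Example32_ordZero, ENat.toNat_coe, show n + p + 1 - p = n + 1 by omega]
  ext i
  rw [Finsupp.update_apply]
  split_ifs with h
  · rw [h, Finsupp.single_eq_same]
  · rw [Finsupp.filter_apply, Finsupp.single_eq_of_ne h, Finsupp.single_eq_of_ne h, ite_self]

/-- **The quadratic sequence along `φ`, one step**: the point blow-up at `x_n`, read at the lift
`b = (0,0,0,b₄)` of `φ` (`b₄ = 0`, or `p ∣ n + 1` and `b₄ = λᵢ^p`), is the state `x_{n+1}` (`p > 1`).
[cite: CossartPiltant2019, Example 3.2 (p. 45)] -/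
theorem cp19Example32_step {p : ℕ} (hp : 1 < p) (n : ℕ) (b : Fin 4 → K) (hb0 : b 0 = 0)
    (hb1 : b 1 = 0) (hb2 : b 2 = 0) (h : b 3 = 0 ∨ p ∣ n + 1) :
    step p Finset.univ 1 b (cp19Example32 p n) = cp19Example32 p (n + 1) :=
  CState.eq_of_fields' (cp19Example32_step_F hp n b hb0 hb1 hb2 h) (cp19Example32_step_r p n b)
    (cp19Example32_step_exc p n b hb0 hb1)

/-- `ω` STALLS at every step of the sequence: `ω(x_{n+1}) = ω(x_n) = p`.
[cite: CossartPiltant2019, Example 3.2 (p. 45) with Thm. 3.6 (p. 35)] -/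
theorem cp19Example32_omegaStalls {p : ℕ} (hp : 1 < p) (n : ℕ) (b : Fin 4 → K) (hb0 : b 0 = 0)
    (hb1 : b 1 = 0) (hb2 : b 2 = 0) (h : b 3 = 0 ∨ p ∣ n + 1) :
    OmegaStalls p Finset.univ 1 b (cp19Example32 p n) := by
  unfold OmegaStalls
  rw [cp19Example32_step hp n b hb0 hb1 hb2 h, cp19Example32_omega (by omega) (n + 1),
    cp19Example32_omega (by omega) n]

/-- … so `ω` neither increases … [cite: CossartPiltant2019, Example 3.2 (p. 45) with Thm. 3.6 (p. 35)] -/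
theorem cp19Example32_not_omegaIncreases {p : ℕ} (hp : 1 < p) (n : ℕ) (b : Fin 4 → K) (hb0 : b 0 = 0)
    (hb1 : b 1 = 0) (hb2 : b 2 = 0) (h : b 3 = 0 ∨ p ∣ n + 1) :
    ¬ OmegaIncreases p Finset.univ 1 b (cp19Example32 p n) := by
  unfold OmegaIncreases
  rw [cp19Example32_omegaStalls hp n b hb0 hb1 hb2 h]
  exact lt_irrefl _

/-- … nor drops, … [cite: CossartPiltant2019, Example 3.2 (p. 45) with Thm. 3.6 (p. 35)] -/
theorem cp19Example32_not_omegaDrops {p : ℕ} (hp : 1 < p) (n : ℕ) (b : Fin 4 → K) (hb0 : b 0 = 0)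
    (hb1 : b 1 = 0) (hb2 : b 2 = 0) (h : b 3 = 0 ∨ p ∣ n + 1) :
    ¬ OmegaDrops p Finset.univ 1 b (cp19Example32 p n) := by
  unfold OmegaDrops
  rw [cp19Example32_omegaStalls hp n b hb0 hb1 hb2 h]
  exact lt_irrefl _

/-- … and `ε` is constant (`ε(x_{n+1}) = ε(x_n) = p + 1`; cf. Prop. 3.8 (2)(a) "`ε(x̃_r) = ε(x_{r₀})`").
[cite: CossartPiltant2019, Example 3.2 (p. 45) with Prop. 3.8 (p. 41–42)] -/
theorem cp19Example32_not_epsilonIncreases {p : ℕ} (hp : 1 < p) (n : ℕ) (b : Fin 4 → K) (hb0 : b 0 = 0)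
    (hb1 : b 1 = 0) (hb2 : b 2 = 0) (h : b 3 = 0 ∨ p ∣ n + 1) :
    ¬ EpsilonIncreases p Finset.univ 1 b (cp19Example32 p n) := by
  unfold EpsilonIncreases
  rw [cp19Example32_step hp n b hb0 hb1 hb2 h, cp19Example32_epsilon, cp19Example32_epsilon]
  exact lt_irrefl _

/-- **The whole quadratic sequence along `φ`.**  `walk bs n` = the state after `n` point blow-ups read at
the lifts `bs 0, bs 1, …` of the arc. [cite: CossartPiltant2019, Example 3.2 (p. 45)] -/
def cp19Example32Walk (p : ℕ) (bs : ℕ → Fin 4 → K) : ℕ → CState (Fin 4) K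
  | 0 => cp19Example32 p 0
  | n + 1 => step p Finset.univ 1 (bs n) (cp19Example32Walk p bs n)

/-- For every sequence of lifts `bs n = (0,0,0,b₄⁽ⁿ⁾)` with `b₄⁽ⁿ⁾ = 0` unless `p ∣ n + 1` (the lifts of
`φ(u₄) = ϑ(t)^p`: `b₄⁽ⁿ⁾ = λᵢ^p` at `n + 1 = ip`), the `n`-th state of the quadratic sequence is `x_n`:
"`h_r := T_r^p + (u₂^{(r)})^r((u₂^{(r)})^p v₄^{(r)} (u₃^{(r)})^p + u₃^{(r)}(u₁^{(r)})^p)`" for every `r`.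
[cite: CossartPiltant2019, Example 3.2 (p. 45)] -/
theorem cp19Example32Walk_eq {p : ℕ} (hp : 1 < p) (bs : ℕ → Fin 4 → K)
    (hbs : ∀ n, bs n 0 = 0 ∧ bs n 1 = 0 ∧ bs n 2 = 0 ∧ (bs n 3 = 0 ∨ p ∣ n + 1)) (n : ℕ) :
    cp19Example32Walk p bs n = cp19Example32 p n := by
  induction n with
  | zero => rfl
  | succ n ih =>
    obtain ⟨h0, h1, h2, h3⟩ := hbs n
    show step p Finset.univ 1 (bs n) (cp19Example32Walk p bs n) = _
    rw [ih]
    exact cp19Example32_step hp n (bs n) h0 h1 h2 h3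

/-- **Summary** ("Therefore `φ` fulfills alternative (2) of proposition 3.8" — alternative (1), "`Z_r(φ)`
is permissible of the first kind at `x_r` for every `r ≥ r₀`", fails): along the quadratic sequence,
for every `n`, `m(x_n) = p` is kept (`x_{n+1}` is `p`-fold), `ω(x_n) = p`, `ε(x_n) = p + 1`, and the
surface `Z_n = V(T_n,u₁^{(n)},u₃^{(n)})` is Hironaka-permissible with `ε(z_n) = ε(x_n) − 1` but is NOT a
permissible centre (neither kind). [cite: CossartPiltant2019, Example 3.2 (p. 45) with Prop. 3.8 (p. 41–42)] -/
theorem cp19Example32_summary {p : ℕ} (hp : 1 < p) (bs : ℕ → Fin 4 → K)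
    (hbs : ∀ n, bs n 0 = 0 ∧ bs n 1 = 0 ∧ bs n 2 = 0 ∧ (bs n 3 = 0 ∨ p ∣ n + 1)) (n : ℕ) :
    IsEquimultiplePoint p Finset.univ 1 (bs n) (cp19Example32Walk p bs n) ∧
    (cp19Example32Walk p bs n).omega = p ∧
    (cp19Example32Walk p bs n).epsilon = (p + 1 : ℕ) ∧
    IsHironakaPermissible p cp19Example32Centre (cp19Example32Walk p bs n) ∧
    epsilonAlong cp19Example32Centre (cp19Example32Walk p bs n) + 1 = (cp19Example32Walk p bs n).epsilon ∧
    ¬ IsPermissibleCentre p cp19Example32Centre (cp19Example32Walk p bs n) := by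
  obtain ⟨h0, h1, h2, -⟩ := hbs n
  rw [cp19Example32Walk_eq hp bs hbs n]
  exact ⟨cp19Example32_isEquimultiplePoint p n (bs n) h0 h1 h2, cp19Example32_omega (by omega) n,
    cp19Example32_epsilon p n, cp19Example32_isHironakaPermissible p n, cp19Example32_epsilonAlong_add_one p n,
    cp19Example32_not_isPermissibleCentre (by omega) n⟩

end Step

end Example

end CentreBlowup

end Literature.AlgebraicGeometry.Resolution

end
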